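import Summits.NavierStokesRegularity.NavierStokesRegularity.Theorems.ExtremiserTransienceTwoThirdsLayerBound
import HarnessLib

/-!
# Route `ExtremiserTransience`, crux `NearExtremalTransiencePerFlow` (stmt-NavierStokesRegularity-26567), LINE g10-1 «two_thirds»
# (ns-idea-10 g10), stub S2 `FirstOrderIdentity`: the LAYER JUNK, integrated form

Helper file for S2 (`--supports stmt-NavierStokesRegularity-26567`), sequel of `…TwoThirdsLayerBound`.  Integrating the collected
pointwise bound `abs_layerIntegrand_le_collected` over a bounded measurable set `Λ` (in S2: the shell `B(c,R+ℓ) ∖ B(c,R)`, on which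
`‖Dʲχ‖ ≤ kⱼ`) gives

  `∫_Λ |f₁(φ₀) + χ²(3·sd − κ⋆(zd+wd))| ≤ 11K³·(Θ·(Z_Λ + W_Λ) + s(k₁+k₂)(‖V‖²_{L²(Λ)} + ‖Dψ‖²_{L²(Λ)}) + t(k₂+k₃)‖ψ‖²_{L²(Λ)}
      + k₁(‖DV‖²_{L²(Λ)} + ‖D²ψ‖²_{L²(Λ)}))`

(`setIntegral_abs_layerIntegrand_le`), `Θ = 1 + k₁ + (k₁+k₂)/s + (k₂+k₃)/t`: the layer bulk `Z_Λ + W_Λ` is `η`-small by the light-layer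
clause of S2 and every other term carries a power of `ℓ⁻¹` through `k₁, k₂, k₃`.

HONEST FRAMING: calculus/measure bookkeeping; nothing about Navier–Stokes regularity or blow-up is proved; S2, the crux ⟨26567⟩ and NS
regularity are OPEN; no summit is proved by a line. [folklore]
-/

noncomputable section

open scoped Topology InnerProductSpace RealInnerProductSpace ENNReal ContDiff
open MeasureTheory Filter Set Metric
open Literature.Analysis.FluidPDE
open Summit.NavierStokesRegularity.NavierStokesRegularity.Theorems.DepletionLadder.KStar.HalfSpace
open Summit.NavierStokesRegularity.NavierStokesRegularity.Theorems.DepletionLadder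
open Summit.NavierStokesRegularity.NavierStokesRegularity.Theorems.NearExtremalTransiencePerFlow.LocalMaximiser

namespace Summit.NavierStokesRegularity.NavierStokesRegularity.Theorems.NearExtremalTransiencePerFlow.TwoThirds

-- the summit's namespace repeats the problem name by convention (D-0017)
set_option linter.dupNamespace false

variable {V ψ : E3 → E3} {χ : E3 → ℝ}

/-- A continuous function is integrable on a bounded set. [folklore] -/
theorem integrableOn_of_continuous_isBounded {f : E3 → ℝ} (hf : Continuous f) {Λ : Set E3} (hΛb : Bornology.IsBounded Λ) :
    IntegrableOn f Λ := by
  obtain ⟨r, hr⟩ := hΛb.subset_closedBall (0 : E3)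
  exact (hf.continuousOn.integrableOn_compact (isCompact_closedBall 0 r)).mono_set hr

/-- **THE LAYER ESTIMATE (integrated form)** — see the module docstring. [folklore] -/
theorem setIntegral_abs_layerIntegrand_le (hV : ContDiff ℝ (⊤ : ℕ∞) V) (hχ : ContDiff ℝ (⊤ : ℕ∞) χ) (hψ : ContDiff ℝ (⊤ : ℕ∞) ψ)
    (hχ01 : ∀ x, 0 ≤ χ x ∧ χ x ≤ 1) {A₁ K k₁ k₂ k₃ s t : ℝ} (hA : ∀ x, ‖fderiv ℝ V x‖ ≤ A₁) (hV1 : ∀ x, ‖V x‖ ≤ 1)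
    (hK : 1 ≤ K) (hAK : A₁ ≤ K) (hκK : kStar ≤ K) (hcK : ‖curlCLM‖ ≤ K) (hs : 0 < s) (ht : 0 < t)
    {Λ : Set E3} (hΛm : MeasurableSet Λ) (hΛb : Bornology.IsBounded Λ)
    (hk₁ : ∀ x ∈ Λ, ‖fderiv ℝ χ x‖ ≤ k₁) (hk₂ : ∀ x ∈ Λ, ‖iteratedFDeriv ℝ 2 χ x‖ ≤ k₂)
    (hk₃ : ∀ x ∈ Λ, ‖iteratedFDeriv ℝ 3 χ x‖ ≤ k₃) :
    ∫ x in Λ, |f1 V (fun y => χ y • curl ψ y - χ y • V y - curl (fun z => χ z • ψ z) y) x +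
        χ x ^ 2 * (3 * sd V x - kStar * (zd V x + wd V x))| ≤
      11 * K ^ 3 * ((1 + k₁ + (k₁ + k₂) / s + (k₂ + k₃) / t) * ((∫ x in Λ, zd V x) + ∫ x in Λ, wd V x) +
        s * (k₁ + k₂) * ((∫ x in Λ, ‖V x‖ ^ 2) + ∫ x in Λ, ‖fderiv ℝ ψ x‖ ^ 2) +
        t * (k₂ + k₃) * (∫ x in Λ, ‖ψ x‖ ^ 2) +
        k₁ * ((∫ x in Λ, ‖fderiv ℝ V x‖ ^ 2) + ∫ x in Λ, ‖iteratedFDeriv ℝ 2 ψ x‖ ^ 2)) := by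
  have hψ2 : ContDiff ℝ 2 ψ := hψ.of_le (by norm_cast)
  -- the seven densities are continuous, hence integrable on `Λ`
  have czd : Continuous (zd V) := continuous_zd' hV
  have cwd : Continuous (wd V) := continuous_wd' hV
  have cV : Continuous fun x => ‖V x‖ ^ 2 := (hV.continuous.norm).pow 2
  have cDψ : Continuous fun x => ‖fderiv ℝ ψ x‖ ^ 2 := ((hψ.continuous_fderiv (by simp)).norm).pow 2
  have cψ : Continuous fun x => ‖ψ x‖ ^ 2 := (hψ.continuous.norm).pow 2
  have cDV : Continuous fun x => ‖fderiv ℝ V x‖ ^ 2 := ((hV.continuous_fderiv (by simp)).norm).pow 2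
  have cD2ψ : Continuous fun x => ‖iteratedFDeriv ℝ 2 ψ x‖ ^ 2 := ((hψ2.continuous_iteratedFDeriv (m := 2) le_rfl).norm).pow 2
  have izd := integrableOn_of_continuous_isBounded czd hΛb
  have iwd := integrableOn_of_continuous_isBounded cwd hΛb
  have iV := integrableOn_of_continuous_isBounded cV hΛb
  have iDψ := integrableOn_of_continuous_isBounded cDψ hΛb
  have iψ := integrableOn_of_continuous_isBounded cψ hΛb
  have iDV := integrableOn_of_continuous_isBounded cDV hΛb
  have iD2ψ := integrableOn_of_continuous_isBounded cD2ψ hΛb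
  -- the majorant
  set Θ : ℝ := 1 + k₁ + (k₁ + k₂) / s + (k₂ + k₃) / t with hΘ
  set M : E3 → ℝ := fun x => 11 * K ^ 3 * (Θ * (zd V x + wd V x) +
    s * (k₁ + k₂) * (‖V x‖ ^ 2 + ‖fderiv ℝ ψ x‖ ^ 2) + t * (k₂ + k₃) * ‖ψ x‖ ^ 2 +
    k₁ * (‖fderiv ℝ V x‖ ^ 2 + ‖iteratedFDeriv ℝ 2 ψ x‖ ^ 2)) with hM
  have i1 : IntegrableOn (fun x => Θ * (zd V x + wd V x)) Λ := (izd.add iwd).const_mul Θ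
  have i2 : IntegrableOn (fun x => s * (k₁ + k₂) * (‖V x‖ ^ 2 + ‖fderiv ℝ ψ x‖ ^ 2)) Λ := (iV.add iDψ).const_mul _
  have i3 : IntegrableOn (fun x => t * (k₂ + k₃) * ‖ψ x‖ ^ 2) Λ := iψ.const_mul _
  have i4 : IntegrableOn (fun x => k₁ * (‖fderiv ℝ V x‖ ^ 2 + ‖iteratedFDeriv ℝ 2 ψ x‖ ^ 2)) Λ := (iDV.add iD2ψ).const_mul _
  have i12 : IntegrableOn (fun x => Θ * (zd V x + wd V x) + s * (k₁ + k₂) * (‖V x‖ ^ 2 + ‖fderiv ℝ ψ x‖ ^ 2)) Λ := i1.add i2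
  have i123 : IntegrableOn (fun x => Θ * (zd V x + wd V x) + s * (k₁ + k₂) * (‖V x‖ ^ 2 + ‖fderiv ℝ ψ x‖ ^ 2) +
      t * (k₂ + k₃) * ‖ψ x‖ ^ 2) Λ := i12.add i3
  have i1234 : IntegrableOn (fun x => Θ * (zd V x + wd V x) + s * (k₁ + k₂) * (‖V x‖ ^ 2 + ‖fderiv ℝ ψ x‖ ^ 2) +
      t * (k₂ + k₃) * ‖ψ x‖ ^ 2 + k₁ * (‖fderiv ℝ V x‖ ^ 2 + ‖iteratedFDeriv ℝ 2 ψ x‖ ^ 2)) Λ := i123.add i4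
  have hMint : IntegrableOn M Λ := by
    simp only [hM]
    exact i1234.const_mul _
  -- pointwise on `Λ`
  have hpt : ∀ x ∈ Λ, |f1 V (fun y => χ y • curl ψ y - χ y • V y - curl (fun z => χ z • ψ z) y) x +
      χ x ^ 2 * (3 * sd V x - kStar * (zd V x + wd V x))| ≤ M x := fun x hx =>
    abs_layerIntegrand_le_collected (ψ := ψ) hV hχ hψ (hχ01 x).1 (hχ01 x).2 (hA x) (hV1 x) (hk₁ x hx) (hk₂ x hx) (hk₃ x hx)
      hK hAK hκK hcK hs ht
  have hmono : ∫ x in Λ, |f1 V (fun y => χ y • curl ψ y - χ y • V y - curl (fun z => χ z • ψ z) y) x +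
      χ x ^ 2 * (3 * sd V x - kStar * (zd V x + wd V x))| ≤ ∫ x in Λ, M x :=
    integral_mono_of_nonneg (Eventually.of_forall fun x => abs_nonneg _) hMint
      ((ae_restrict_iff' hΛm).2 (Eventually.of_forall hpt))
  refine hmono.trans (le_of_eq ?_)
  -- compute the integral of the majorant
  simp only [hM]
  rw [integral_const_mul, integral_add i123 i4, integral_add i12 i3, integral_add i1 i2, integral_const_mul,
    integral_const_mul, integral_const_mul, integral_const_mul, integral_add izd iwd, integral_add iV iDψ,
    integral_add iDV iD2ψ]

end Summit.NavierStokesRegularity.NavierStokesRegularity.Theorems.NearExtremalTransiencePerFlow.TwoThirds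

end
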